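import Summits.KontsevichZagierPeriods.KontsevichZagierPeriods.Theorems.ValuedFieldSpecialisationCTConstructionDilateMap
import Summits.KontsevichZagierPeriods.KontsevichZagierPeriods.Theorems.ValuedFieldSpecialisationCTConstructionDominatedDilate
import Literature.NumberTheory.Transcendental.KZDominatedFamilyRelations
import Summits.KontsevichZagierPeriods.KontsevichZagierPeriods.Theorems.ValuedFieldSpecialisationCTConstructionAltSumChoosePow

/-!
# Route ValuedFieldSpecialisation — crux `CTConstruction`: the dilation operator `Θ` of the reduction

Helper toward crux stmt-KontsevichZagierPeriods-3495 (`CTConstruction`), line `registered`, reshape r3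
(dilation elimination of the class core `stub_specialFibreRigidityOfEval`). The operator
`Θ = slabMap 0 1 ∘ lift T` — Jacobian-free dilation of the parameter `s = z 0` by a rational `0 < μ`
(`T ⟨k+1, r⟩ = [r']`, `r'.domain = {z | update z 0 (μ z 0) ∈ r.domain}`, `r'.integrand = r.integrand ∘ update`,
landed `stub_dilateMap_mem_fibredRelations` / `stub_exists_dilate`, file `…CTConstructionDilateMap`), followed by
the restriction to the unit slab `0 < z 0 < 1` (`KZ.slabMap`, Literature `KZFibredRelations`) — is an additive
endomorphism of `KZ.FormalRep` which

* maps `KZ.fibredRelations` into itself (`theta_mem_fibredRelations`), hence so do its iterates and every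
  integer combination of iterates (`thetaIter_mem_fibredRelations`, `altSum_thetaIter_mem_fibredRelations`);
* maps a dominated family to a dominated family WITH THE SAME special fibre (`isDominatedFamily_theta`:
  dilation `stub_isDominatedFamily_dilate`, file `…CTConstructionDominatedDilate`, then slab restriction
  `isDominatedFamily_slabRestrict`), hence maps the subgroup of dominated pairs `([S], [r₀])` into itself
  acting as the identity on the second component (`theta_mem_closure_dominatedPairs` and its iterates;
  the alternating combination `Σ (-1)^(n-i) C(n,i) Θⁱ` kills the special fibre for `n ≥ 1`,
  `altSum_thetaIter_mem_closure_dominatedPairs`).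

Everything is stated for an arbitrary generatorwise choice `T` of dilates (hypotheses `hT0`, `hT`), as in
the landed weight/dilate files; no definitions. Sources: M. Kontsevich, D. Zagier, *Periods* (2001), §1.2;
the fibred calculus and dominated families are this route's encoding.
-/

noncomputable section

namespace Summit.KontsevichZagierPeriods.ValuedFieldSpecialisation

open MeasureTheory Set Filter
open scoped Topology
open Literature.NumberTheory.Transcendental Literature.NumberTheory.Transcendental.KZ

/-! ### Slab restriction keeps domination and the special fibre -/

/-- Restricting a dominated family to the unit slab `0 < z 0 < 1` keeps the domination and the special
fibre: near `s = 0⁺` nothing changes. [folklore] -/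
theorem isDominatedFamily_slabRestrict {n : ℕ} {S : IntegralRep (n + 1)} {r₀ g : IntegralRep n}
    (h : IsDominatedFamily S r₀ g) : IsDominatedFamily (S.slabRestrict 0 1) r₀ g := by
  obtain ⟨⟨ε, hε, hbd⟩, hmem, hlim⟩ := h
  refine ⟨⟨ε, hε, fun z hz h0 hzε => hbd z hz.1 h0 hzε⟩, ?_, ?_⟩
  · filter_upwards [hmem] with x hx
    filter_upwards [hx, Ioo_mem_nhdsGT (zero_lt_one' ℝ)] with s hs hs01
    rw [IntegralRep.domain_slabRestrict, mem_inter_iff, vecCons_mem_paramSlab, hs]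
    simp only [Rat.cast_zero, Rat.cast_one, hs01, and_true]
  · simpa only [IntegralRep.integrand_slabRestrict] using hlim

/-! ### The operator `Θ` -/

section Theta

variable {μ : ℚ} (hμ : 0 < μ) (T : (Σ k, IntegralRep k) → FormalRep)
  (hT0 : ∀ r : IntegralRep 0, T ⟨0, r⟩ = 0)
  (hT : ∀ (k : ℕ) (r : IntegralRep (k + 1)), ∃ r' : IntegralRep (k + 1), T ⟨k + 1, r⟩ = of r' ∧
    r'.domain = {z | Function.update z 0 ((μ : ℝ) * z 0) ∈ r.domain} ∧
    r'.integrand = fun z => r.integrand (Function.update z 0 ((μ : ℝ) * z 0)))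

include hμ hT0 hT in
/-- `Θ = slabMap 0 1 ∘ lift T` maps fibred relations to fibred relations. [folklore] -/
theorem theta_mem_fibredRelations {c : FormalRep} (hc : c ∈ fibredRelations) :
    slabMap 0 1 (FreeAbelianGroup.lift T c) ∈ fibredRelations :=
  slabMap_mem_fibredRelations (stub_dilateMap_mem_fibredRelations μ hμ T hT0 hT c hc) 0 1

include hμ hT0 hT in
/-- Iterates of `Θ` map fibred relations to fibred relations. [folklore] -/
theorem thetaIter_mem_fibredRelations (n : ℕ) {c : FormalRep} (hc : c ∈ fibredRelations) :
    (fun x => slabMap 0 1 (FreeAbelianGroup.lift T x))^[n] c ∈ fibredRelations := by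
  induction n generalizing c with
  | zero => simpa using hc
  | succ n ih =>
    rw [Function.iterate_succ_apply]
    exact ih (theta_mem_fibredRelations hμ T hT0 hT hc)

include hμ hT0 hT in
/-- Every integer combination of iterates of `Θ` maps fibred relations to fibred relations; in
particular the alternating combination `Σ_{i ≤ n} (-1)^(n-i) C(n,i) Θⁱ`. [folklore] -/
theorem altSum_thetaIter_mem_fibredRelations (n : ℕ) {c : FormalRep} (hc : c ∈ fibredRelations) :
    (∑ i ∈ Finset.range (n + 1), ((-1 : ℤ) ^ (n - i) * (n.choose i : ℤ)) •
      (fun x => slabMap 0 1 (FreeAbelianGroup.lift T x))^[i] c) ∈ fibredRelations :=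
  fibredRelations.sum_mem fun i _ =>
    fibredRelations.zsmul_mem (thetaIter_mem_fibredRelations hμ T hT0 hT i hc) _

/-- `Θ` on a family: the unit-slab restriction of its chosen dilate. [folklore] -/
theorem theta_of {k : ℕ} (r r' : IntegralRep (k + 1)) (hr' : T ⟨k + 1, r⟩ = of r') :
    slabMap 0 1 (FreeAbelianGroup.lift T (of r)) = of (r'.slabRestrict 0 1) := by
  have : FreeAbelianGroup.lift T (of r) = T ⟨k + 1, r⟩ := FreeAbelianGroup.lift_apply_of _ _
  rw [this, hr', slabMap_of]

include hμ hT in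
/-- `Θ` maps a dominated family to a dominated family with the SAME special fibre and envelope.
[folklore] -/
theorem isDominatedFamily_theta {n : ℕ} {S : IntegralRep (n + 1)} {r₀ g : IntegralRep n}
    (h : IsDominatedFamily S r₀ g) :
    ∃ S' : IntegralRep (n + 1), slabMap 0 1 (FreeAbelianGroup.lift T (of S)) = of S' ∧
      IsDominatedFamily S' r₀ g := by
  obtain ⟨S₁, hS₁, hdom, hint⟩ := hT n S
  exact ⟨S₁.slabRestrict 0 1, theta_of T S S₁ hS₁,
    isDominatedFamily_slabRestrict (stub_isDominatedFamily_dilate μ hμ n S S₁ r₀ g h hdom hint)⟩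

include hμ hT in
/-- `Θ × id` maps the subgroup generated by the dominated pairs `([S], [r₀])` into itself. [folklore] -/
theorem theta_mem_closure_dominatedPairs {G y : FormalRep}
    (hGy : (G, y) ∈ AddSubgroup.closure {v : FormalRep × FormalRep | ∃ (n : ℕ) (S : IntegralRep (n + 1))
      (r₀ g : IntegralRep n), IsDominatedFamily S r₀ g ∧ v = (of S, of r₀)}) :
    (slabMap 0 1 (FreeAbelianGroup.lift T G), y) ∈ AddSubgroup.closure {v : FormalRep × FormalRep |
      ∃ (n : ℕ) (S : IntegralRep (n + 1)) (r₀ g : IntegralRep n), IsDominatedFamily S r₀ g ∧ v = (of S, of r₀)} := by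
  -- the additive map `Θ × id`
  let Φ : FormalRep × FormalRep →+ FormalRep × FormalRep :=
    AddMonoidHom.prodMap ((slabMap 0 1).comp (FreeAbelianGroup.lift T)) (AddMonoidHom.id FormalRep)
  have hΦ : ∀ v : FormalRep × FormalRep, Φ v = (slabMap 0 1 (FreeAbelianGroup.lift T v.1), v.2) :=
    fun v => rfl
  rw [← hΦ (G, y)]
  refine (AddSubgroup.closure_le (K := AddSubgroup.comap Φ (AddSubgroup.closure _))).mpr ?_ hGy
  rintro v ⟨n, S, r₀, g, hS, rfl⟩
  rw [AddSubgroup.coe_comap, mem_preimage, hΦ]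
  obtain ⟨S', hS', hdom'⟩ := isDominatedFamily_theta hμ T hT hS
  rw [hS']
  exact AddSubgroup.subset_closure ⟨n, S', r₀, g, hdom', rfl⟩

include hμ hT in
/-- Iterates of `Θ × id` map the subgroup of dominated pairs into itself. [folklore] -/
theorem thetaIter_mem_closure_dominatedPairs (m : ℕ) {G y : FormalRep}
    (hGy : (G, y) ∈ AddSubgroup.closure {v : FormalRep × FormalRep | ∃ (n : ℕ) (S : IntegralRep (n + 1))
      (r₀ g : IntegralRep n), IsDominatedFamily S r₀ g ∧ v = (of S, of r₀)}) :
    ((fun x => slabMap 0 1 (FreeAbelianGroup.lift T x))^[m] G, y) ∈ AddSubgroup.closure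
      {v : FormalRep × FormalRep | ∃ (n : ℕ) (S : IntegralRep (n + 1)) (r₀ g : IntegralRep n),
        IsDominatedFamily S r₀ g ∧ v = (of S, of r₀)} := by
  induction m generalizing G with
  | zero => simpa using hGy
  | succ m ih =>
    rw [Function.iterate_succ_apply]
    exact ih (theta_mem_closure_dominatedPairs hμ T hT hGy)

include hμ hT in
/-- The alternating combination `Σ_{i ≤ n} (-1)^(n-i) C(n,i) Θⁱ G` of a dominated combination `G` with
special-fibre class `y` is a dominated combination with special-fibre class
`(Σ_{i ≤ n} (-1)^(n-i) C(n,i)) • y`, which is `0` for `n ≥ 1` and `y` for `n = 0`. [folklore] -/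
theorem altSum_thetaIter_mem_closure_dominatedPairs (n : ℕ) {G y : FormalRep}
    (hGy : (G, y) ∈ AddSubgroup.closure {v : FormalRep × FormalRep | ∃ (n : ℕ) (S : IntegralRep (n + 1))
      (r₀ g : IntegralRep n), IsDominatedFamily S r₀ g ∧ v = (of S, of r₀)}) :
    ((∑ i ∈ Finset.range (n + 1), ((-1 : ℤ) ^ (n - i) * (n.choose i : ℤ)) •
      (fun x => slabMap 0 1 (FreeAbelianGroup.lift T x))^[i] G),
      (if n = 0 then y else 0)) ∈ AddSubgroup.closure
      {v : FormalRep × FormalRep | ∃ (n : ℕ) (S : IntegralRep (n + 1)) (r₀ g : IntegralRep n),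
        IsDominatedFamily S r₀ g ∧ v = (of S, of r₀)} := by
  have hsum : (∑ i ∈ Finset.range (n + 1), ((-1 : ℤ) ^ (n - i) * (n.choose i : ℤ)) •
      ((fun x => slabMap 0 1 (FreeAbelianGroup.lift T x))^[i] G, y)) ∈ AddSubgroup.closure
      {v : FormalRep × FormalRep | ∃ (n : ℕ) (S : IntegralRep (n + 1)) (r₀ g : IntegralRep n),
        IsDominatedFamily S r₀ g ∧ v = (of S, of r₀)} :=
    AddSubgroup.sum_mem _ fun i _ =>
      AddSubgroup.zsmul_mem _ (thetaIter_mem_closure_dominatedPairs hμ T hT i hGy) _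
  have hcoef : (∑ i ∈ Finset.range (n + 1), ((-1 : ℤ) ^ (n - i) * (n.choose i : ℤ))) =
      if n = 0 then 1 else 0 := by
    have h := stub_altSum_choose_mul_pow n 0 (Nat.zero_le n)
    simp only [pow_zero, mul_one] at h
    rw [h]
    by_cases hn : n = 0
    · subst hn; simp
    · simp [hn, Ne.symm hn]
  have heq : ((∑ i ∈ Finset.range (n + 1), ((-1 : ℤ) ^ (n - i) * (n.choose i : ℤ)) •
      (fun x => slabMap 0 1 (FreeAbelianGroup.lift T x))^[i] G), (if n = 0 then y else 0)) =
      ∑ i ∈ Finset.range (n + 1), ((-1 : ℤ) ^ (n - i) * (n.choose i : ℤ)) •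
        ((fun x => slabMap 0 1 (FreeAbelianGroup.lift T x))^[i] G, y) := by
    ext
    · simp only [Prod.fst_sum, Prod.smul_fst]
    · simp only [Prod.snd_sum, Prod.smul_snd, ← Finset.sum_smul, hcoef]
      split_ifs <;> simp
  rw [heq]
  exact hsum

end Theta

/-- **Registered stub `stub_thetaPlumbing`** (crux `CTConstruction`, line `registered`, reshape r3): the two facts the
main induction uses about the alternating combination `Σ (-1)^(n-i) C(n,i) Θⁱ` — it maps fibred relations to fibred
relations and dominated pairs to dominated pairs with special fibre `if n = 0 then y else 0`. [folklore] -/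
theorem stub_thetaPlumbing : ∀ (μ : ℚ), 0 < μ → ∀ (T : (Σ n, Literature.NumberTheory.Transcendental.KZ.IntegralRep n) → Literature.NumberTheory.Transcendental.KZ.FormalRep), (∀ ρ : Literature.NumberTheory.Transcendental.KZ.IntegralRep 0, T ⟨0, ρ⟩ = 0) → (∀ (n : ℕ) (ρ : Literature.NumberTheory.Transcendental.KZ.IntegralRep (n + 1)), ∃ ρ' : Literature.NumberTheory.Transcendental.KZ.IntegralRep (n + 1), T ⟨n + 1, ρ⟩ = Literature.NumberTheory.Transcendental.KZ.of ρ' ∧ ρ'.domain = {z | Function.update z 0 ((μ : ℝ) * z 0) ∈ ρ.domain} ∧ ρ'.integrand = fun z => ρ.integrand (Function.update z 0 ((μ : ℝ) * z 0))) → ∀ (n : ℕ) (G y : Literature.NumberTheory.Transcendental.KZ.FormalRep), (G, y) ∈ AddSubgroup.closure {v : Literature.NumberTheory.Transcendental.KZ.FormalRep × Literature.NumberTheory.Transcendental.KZ.FormalRep | ∃ (n : ℕ) (S : Literature.NumberTheory.Transcendental.KZ.IntegralRep (n + 1)) (r₀ g : Literature.NumberTheory.Transcendental.KZ.IntegralRep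 n), Literature.NumberTheory.Transcendental.KZ.IsDominatedFamily S r₀ g ∧ v = (Literature.NumberTheory.Transcendental.KZ.of S, Literature.NumberTheory.Transcendental.KZ.of r₀)} → (G ∈ Literature.NumberTheory.Transcendental.KZ.fibredRelations → (∑ i ∈ Finset.range (n + 1), ((-1 : ℤ) ^ (n - i) * (n.choose i : ℤ)) • Nat.iterate (fun x => Literature.NumberTheory.Transcendental.KZ.slabMap 0 1 (FreeAbelianGroup.lift T x)) i G) ∈ Literature.NumberTheory.Transcendental.KZ.fibredRelations) ∧ ((∑ i ∈ Finset.range (n + 1), ((-1 : ℤ) ^ (n - i) * (n.choose i : ℤ)) • Nat.iterate (fun x => Literature.NumberTheory.Transcendental.KZ.slabMap 0 1 (FreeAbelianGroup.lift T x)) i G), (if n = 0 then y else 0)) ∈ AddSubgroup.closure {v : Literature.NumberTheory.Transcendental.KZ.FormalRep × Literature.NumberTheory.Transcendental.KZ.FormalRep | ∃ (n : ℕ) (S : Literature.NumberTheory.Transcendental.KZ.IntegralRep (n + 1)) (r₀ g : Literature.NumberTheory.Transcendental.KZ.IntegralRep n), Literature.NumberTheory.Transcendental.KZ.IsDominatedFamily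 S r₀ g ∧ v = (Literature.NumberTheory.Transcendental.KZ.of S, Literature.NumberTheory.Transcendental.KZ.of r₀)} := by
  intro μ hμ T hT0 hT n G y hGy
  exact ⟨fun hG => altSum_thetaIter_mem_fibredRelations hμ T hT0 hT n hG,
    altSum_thetaIter_mem_closure_dominatedPairs hμ T hT n hGy⟩

end Summit.KontsevichZagierPeriods.ValuedFieldSpecialisation
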